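import Literature.MathematicalPhysics.QuantumLattice.TypeClassSidecarReaderUCell
import Literature.MathematicalPhysics.QuantumLattice.TypeClassSidecarReaderTPrimeTransport
import HarnessLib

/-!
# «c2-sector» sidecar readers on a `U`-CELL at `t' ≠ 0`: the sidecar (at `t'`) at the RIGHT end, a `t' = 0` corner
# Markov (C1) certificate TRANSPORTED ALONG `t'` at the LEFT end — zero `U`-price; and the one-anchor kinematic cell

Family `hubbard` (topic `MathematicalPhysics/QuantumLattice`), seat hubbard-downfold-unc-1 (the `U` direction of «a parameter
BOX maps to a certified word»). Two tree facts are composed: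

* `TypeClassSidecarReaderTPrimeTransport` (hubbard-thermal-p2): a `t' = 0` Markov certificate at `β_h` is a hot input at EVERY
  `t'` — `log Z_{β_h}(t, t', U) ≤ (u + β_h |t'| 16/π² + ε) L²` eventually whenever `log Z_{β_h}(t, 0, U) ≤ (u + ε') L²` eventually
  (`eventually_log_partitionFn_sector_le_of_tPrime_anchor_ceiling`; kinematic diagonal-hopping Lipschitz constant `16/π²`);
* `HubbardTTPrimePressureFloorUTransport` §6 (this seat): on a `U`-cell a pressure FLOOR at the RIGHT end moves down in `U`
  and a pressure CEILING at the LEFT end moves up in `U` for free (`…_of_pressure_bounds_UCell`), and from ONE anchor `U₀`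
  both move at kinematic docc prices (`…_of_pressure_bounds_anchorU_kinematic`).

Hence, with the inputs the producers land — a checked «c2-sector» sidecar AT `(β, t, t', U₂)` (`c2Check … = true`, density
`n (q a b) = 2A₀`, claim node on `hubbardOpenBoxTT' a b t t' U₂`) and a CORNER Markov certificate at `(β_h, t, 0, U₁, μ)`
(window `Λ`, corner `x₀`, structured annihilator, dual `L_B`, constant `c`; `cornerEnergyRep`, the `t' = 0` representative):

* §1 CROSS-CORNER, zero `U`-price: for every torus limit of the canonical sector Gibbs states at `(β, t, t', U, n)`, every
  `U ∈ [U₁, U₂]` (`0 ≤ n < 2`, `0 < β_h < β`):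
  `e_Φ(ω) ≤ ((c − β_h μ n) + β_h |t'| 16/π² − Wnum/Wden)/(β − β_h)`
  (`…le_of_c2Check_right_of_cornerMarkovCertificate_tPrimeTransport_left_UCell_allTori`; rectangle corollary; decimal
  edition with `16/π² ≤ 16212/10000` for row files);
* §2 ONE ANCHOR `U₀` (sidecar at `(β, t, t', U₀)`, C1 at `(β_h, t, 0, U₀)`), the cell at EVERY `U`, kinematic `U`-prices:
  `e_Φ(ω) ≤ ((c − β_h μ n) + β_h |t'| 16/π² + β_h·max(U₀ − U, 0)·n/2 − (Wnum/Wden − β·max(U − U₀, 0)·n/2))/(β − β_h)`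
  (`…_of_c2Check_of_cornerMarkovCertificate_tPrimeTransport_allTori_anchorU_kinematic`; rectangle corollary; decimal edition).

So on the cuprate box (`t' = −1/4`) the C1+C2 cells of hubbard-thermal (eng-2's `t' = 0` rectangle certificates at `U = 8`,
p2's sidecars at `t' = −1/4`) word the `U`-FACE: the right half at ZERO price once a sidecar sits at the box's right `U`-end,
the left half at the kinematic price `β_h (U₀ − U)·n/2` of moving the hot ceiling down. Lower edges at `t' ≠ 0` stay the `T = 0`
rows (`TypeClassSidecarReaderUBox` §6): a transported ceiling at `β_c > β` is numerically weaker than the ground-state floor.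

Everything is PROVED; no definition, no named fact, no number. HONEST SCOPE: only the HOT input is transported in `t'`
(price `β_h |t'| 16/π²`, the kinematic constant — a certified thermal `⟨K₂⟩` word would replace `16/π²`); transport in `U`
is antitonicity of the canonical pressure. WHAT THIS IS NOT: no certificate, no phase sentence; nothing moves in `β`.

## Mathlib / tree search

REUSED: `eventually_log_partitionFn_sector_le_of_tPrime_anchor_ceiling`, `sixteen_div_pi_sq_lt` (`TypeClassSidecarReaderTPrimeTransport`);
`IsTorusLimitOfMixture.meanEnergy_hubbardTTPrime_le_of_pressure_bounds_UCell`, `…_of_pressure_bounds_anchorU_kinematic`,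
`density_nonneg_of_type` (`HubbardTTPrimePressureFloorUTransport` §6); `eventually_pressureFloor_of_c2Check_of_le_U`
(`TypeClassSidecarReaderUBox` §2); `c2Check_sound` (`TypeClassSidecarReader`); `eventually_log_partitionFn_sectorHamiltonianTT'_le_of_clusterCertificate`
(`HubbardTorusMarkovClusterPressureTorusLimit`); corner bookkeeping `bondWeightSum_cornerBondWeight`, `siteWeightSum_cornerSiteWeight`,
`siteWeightSum_mul_cornerSiteWeight`, `hubbardTorusTT'_zero_sub_mu`, `relabel_translate_hubbardTorusWith`, `relabel_translate_gibbsDensity`,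
`isHermitian_windowAnnihilator`, `trace_window_mul_windowAnnihilator`; `rectCorner_mem_rectWindow`, `toLex_le_toLex_rectCorner`,
`rectCorner_sub_unitVec_mem_rectWindow`, `rectWindow_subset_halfOpenBox_max`. `rg 'tPrimeTransport_left_UCell|tPrimeTransport_allTori_anchorU'
Literature/MathematicalPhysics/QuantumLattice` (2026-08-27): nothing.

## References

* R. B. Israel, *Convexity in the Theory of Lattice Gases* (1979), Thm. I.3.4, Lemma II.3.1. [cite: Israel1979, Thm. I.3.4] [cite: Israel1979, Lemma II.3.1]
* E. H. Lieb, Commun. Math. Phys. 31 (1973) 327, §V (5.2)–(5.4) (Peierls–Bogoliubov). [cite: Lieb1973, §V (5.2)–(5.4)]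
* E. H. Lieb, M. Loss, *Analysis* (2001), §8, Theorem 8.2 (the kinematic hopping bound's ingredients). [cite: LiebLoss1993, §8, Theorem 8.2]
* D. Poulin, M. B. Hastings, Phys. Rev. Lett. 106 (2011) 080403, eqs. (3)–(8). [cite: PoulinHastings2011, eqs. (3)–(8)]
* D. Ruelle, *Statistical Mechanics: Rigorous Results* (1969), §3.3. [cite: Ruelle1969, §3.3]
-/

noncomputable section

namespace Literature.MathematicalPhysics.QuantumLattice

open Matrix Finset HubbardWave0 ThermodynamicLimit LiebThm1 AndersonCluster Literature.Probability.LatticeModels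
open _root_.Filter
open scoped _root_.Topology ComplexOrder BigOperators

namespace InfVolFermionState

variable {t t' U n β : ℝ} {ω : InfVolFermionState 2} {Ls : ℕ → ℕ}

/-! ### §0 The transported hot input of a corner Markov certificate (generic window) -/

/-- **The `t' = 0` corner Markov certificate at `(β_h, μ, U₁)` as a hot input at `(β_h, t, t', U₁)`**: for every `ε > 0`
eventually `log Re Z_{β_h}(H_{Ls j}(t, t', U₁)|_sector) ≤ ((c − β_h μ n) + β_h |t'| 16/π² + ε)(Ls j)²` (`0 ≤ n < 2`, `β_h > 0`;
window `Λ ⊆ [0, ℓ_w)²` with corner `x₀`, `x₀ − eᵢ ∈ Λ`). [cite: PoulinHastings2011, eqs. (3)–(8)] [cite: Lieb1973, §V (5.2)–(5.4)] -/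
theorem eventually_log_partitionFn_sector_le_of_cornerMarkovCertificate_tPrimeTransport (hn0 : 0 ≤ n) (hn2 : n < 2)
    (t t' U₁ : ℝ) {βh : ℝ} (hβh : 0 < βh) (hLs : Tendsto Ls atTop atTop)
    (μ : ℝ) {Λ : Finset (Site 2)} {x₀ : Site 2} (hx₀ : x₀ ∈ Λ) (hmax : ∀ y ∈ Λ, toLex y ≤ toLex x₀)
    (hcorner : ∀ i : Fin 2, x₀ - unitVec i ∈ Λ) {ℓw : ℕ} (hΛ : Λ ⊆ halfOpenBox 2 ℓw)
    {ι : Type*} (sι : Finset ι) (Sw : ι → Finset (Site 2)) (hS : ∀ i, Sw i ⊆ Λ) (zw : ι → Site 2)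
    (hzw : ∀ i, shiftSet (zw i) (Sw i) ⊆ Λ) {O : ∀ i, FermionOp (Sw i)} (hO : ∀ i ∈ sι, (O i).IsHermitian)
    (g : ι → ℝ) {LB : FermionOp (Λ.erase x₀)} (hLB : LB.IsHermitian) {c : ℝ}
    (hcert : ((Real.exp c : ℂ) • cfc Real.exp LB -
      fermionPartialTrace (PolySite.incl (Finset.erase_subset x₀ Λ))
        (cfc Real.exp (-((βh : ℂ) • (cornerEnergyRep Λ x₀ t U₁ μ + windowAnnihilator sι Λ Sw hS zw hzw O g)) +
          fermionEmbed (PolySite.incl (Finset.erase_subset x₀ Λ)) LB))).PosSemidef) :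
    ∀ ε : ℝ, 0 < ε → ∀ᶠ j in atTop,
      Real.log (partitionFn βh (sectorHamiltonianTT' t t' U₁ n (Ls j))).re ≤
        ((c - βh * μ * n) + βh * |t'| * (16 / Real.pi ^ 2) + ε) * (Ls j : ℝ) ^ 2 := by
  have hKTI : ∀ (L : ℕ) [NeZero L], ∀ w : TorusSite 2 L,
      relabel (Orb.translate w) (hubbardTorusTT' L t 0 U₁ - (μ : ℂ) • totalNumber) =
        hubbardTorusTT' L t 0 U₁ - (μ : ℂ) • totalNumber := fun L _ w => by
    rw [hubbardTorusTT'_zero_sub_mu, relabel_translate_hubbardTorusWith]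
  have hu0 : ∀ ε : ℝ, 0 < ε → ∀ᶠ j in atTop,
      Real.log (partitionFn βh (sectorHamiltonianTT' t 0 U₁ n (Ls j))).re ≤ ((c - βh * μ * n) + ε) * (Ls j : ℝ) ^ 2 :=
    fun ε hε => eventually_log_partitionFn_sectorHamiltonianTT'_le_of_clusterCertificate t U₁ μ βh hn0 hn2.le hLs hx₀ hmax hΛ
      (fun i => bondWeightSum_cornerBondWeight hx₀ (hcorner i)) (siteWeightSum_cornerSiteWeight hx₀)
      (siteWeightSum_mul_cornerSiteWeight hx₀ (-μ)) (isHermitian_windowAnnihilator sι _ Sw hS zw hzw hO g)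
      (fun L _ hL3 hℓL => trace_window_mul_windowAnnihilator (relabel_translate_gibbsDensity L (hKTI L) βh)
        _ sι Sw hS zw hzw O g) hLB hcert hε
  have hu := eventually_log_partitionFn_sector_le_of_tPrime_anchor_ceiling hn0 hn2 t U₁ hβh 0 t' hLs hu0
  rw [sub_zero] at hu
  exact hu

/-! ### §1 Cross-corner cell at `t' ≠ 0`: sidecar (at `t'`) at the right end, transported corner C1 at the left end -/

/-- **UPPER edge on a whole `U`-cell at `t'`, NO `U`-price: checked «c2-sector» sidecar AT `(β, t, t', U₂)` (right end) and
a `t' = 0` CORNER Markov certificate at `(β_h, μ, U₁)` (left end) transported along `t'` at the kinematic price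
`β_h |t'| 16/π²`** (`0 ≤ n < 2` via the type, `0 < β_h < β`, `U ∈ [U₁, U₂]`): for every torus limit `ω` of the canonical
sector Gibbs states of `hubbardTorusTT' L t t' U` at `β` along any `Ls → ∞`,
`e_Φ(ω) ≤ ((c − β_h μ n) + β_h |t'| 16/π² − Wnum/Wden)/(β − β_h)`.
[cite: Israel1979, Lemma II.3.1] [cite: Israel1979, Thm. I.3.4] [cite: PoulinHastings2011, eqs. (3)–(8)] [cite: Lieb1973, §V (5.2)–(5.4)] -/
theorem IsTorusLimitOfMixture.meanEnergy_hubbardTTPrime_le_of_c2Check_right_of_cornerMarkovCertificate_tPrimeTransport_left_UCell_allTori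
    (hn2 : n < 2) {U₁ U₂ : ℝ} (hU : U ∈ Set.Icc U₁ U₂)
    (h : ω.IsTorusLimitOfMixture (sectorGibbsCount n) (fun L => sectorGibbsWeightTT' β t t' U n L)
      (fun L => sectorGibbsVectorTT' t t' U n L) Ls)
    (hLs : Tendsto Ls atTop atTop) {βh : ℝ} (hβh : 0 < βh) (hlt : βh < β)
    -- C2 at `(β, t, t', U₂)`
    {a b : ℕ} (ha : 1 ≤ a) (hb : 1 ≤ b) {rows : List C2Row} {P K q A₀ : ℕ} {Wnum : ℤ} {Wden : ℕ}
    (hcheck : c2Check P K q A₀ a b rows Wnum Wden = true) (hn : n * ((q : ℝ) * a * b) = 2 * A₀)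
    (hnode : ∀ r ∈ rows,
      r.floor ≤ (partitionFn β (spinSectorHamiltonian r.nu r.nd (hubbardOpenBoxTT' a b t t' U₂))).re)
    -- C1 (corner window, `t' = 0` representative) at `(βh, μ, U₁)`
    (μ : ℝ) {Λ : Finset (Site 2)} {x₀ : Site 2} (hx₀ : x₀ ∈ Λ) (hmax : ∀ y ∈ Λ, toLex y ≤ toLex x₀)
    (hcorner : ∀ i : Fin 2, x₀ - unitVec i ∈ Λ) {ℓw : ℕ} (hΛ : Λ ⊆ halfOpenBox 2 ℓw)
    {ι : Type*} (sι : Finset ι) (Sw : ι → Finset (Site 2)) (hS : ∀ i, Sw i ⊆ Λ) (zw : ι → Site 2)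
    (hzw : ∀ i, shiftSet (zw i) (Sw i) ⊆ Λ) {O : ∀ i, FermionOp (Sw i)} (hO : ∀ i ∈ sι, (O i).IsHermitian)
    (g : ι → ℝ) {LB : FermionOp (Λ.erase x₀)} (hLB : LB.IsHermitian) {c : ℝ}
    (hcert : ((Real.exp c : ℂ) • cfc Real.exp LB -
      fermionPartialTrace (PolySite.incl (Finset.erase_subset x₀ Λ))
        (cfc Real.exp (-((βh : ℂ) • (cornerEnergyRep Λ x₀ t U₁ μ + windowAnnihilator sι Λ Sw hS zw hzw O g)) +
          fermionEmbed (PolySite.incl (Finset.erase_subset x₀ Λ)) LB))).PosSemidef) :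
    ω.meanEnergy (hubbardTTPrimeFermionInteraction t t' U) 1 ≤
      ((c - βh * μ * n) + βh * |t'| * (16 / Real.pi ^ 2) - (Wnum : ℝ) / Wden) / (β - βh) := by
  obtain ⟨-, hq, -⟩ := c2Check_sound hcheck ha hb
  have hn0 : 0 ≤ n := density_nonneg_of_type ha hb hq hn
  have hβ : 0 ≤ β := (hβh.trans hlt).le
  exact h.meanEnergy_hubbardTTPrime_le_of_pressure_bounds_UCell hn0 hn2.le hU hLs hβh hlt
    (fun ε hε => eventually_pressureFloor_of_c2Check_of_le_U t t' n le_rfl hβ ha hb hcheck hn hn2.le hnode hLs hε)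
    (eventually_log_partitionFn_sector_le_of_cornerMarkovCertificate_tPrimeTransport hn0 hn2 t t' U₁ hβh hLs μ hx₀ hmax
      hcorner hΛ sι Sw hS zw hzw hO g hLB hcert)

/-- **Rectangle corollary** (`Λ = rectWindow a' b'`, corner `(a' − 1, b' − 1)`, `a', b' ≥ 2` — hubbard-thermal-eng-2's `3 × 2`
shields at `t' = 0`): sidecar at `(β, t, t', U₂)`, rectangle C1 at `(β_h, μ, U₁)`, `U ∈ [U₁, U₂]` ⇒
`e_Φ(ω) ≤ ((c − β_h μ n) + β_h |t'| 16/π² − Wnum/Wden)/(β − β_h)` for every torus limit at `(β, t, t', U, n)`.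
[cite: Israel1979, Lemma II.3.1] [cite: Israel1979, Thm. I.3.4] [cite: PoulinHastings2011, eqs. (3)–(8)] -/
theorem IsTorusLimitOfMixture.meanEnergy_hubbardTTPrime_le_of_c2Check_right_of_rectMarkovCertificate_tPrimeTransport_left_UCell_allTori
    (hn2 : n < 2) {U₁ U₂ : ℝ} (hU : U ∈ Set.Icc U₁ U₂)
    (h : ω.IsTorusLimitOfMixture (sectorGibbsCount n) (fun L => sectorGibbsWeightTT' β t t' U n L)
      (fun L => sectorGibbsVectorTT' t t' U n L) Ls)
    (hLs : Tendsto Ls atTop atTop) {βh : ℝ} (hβh : 0 < βh) (hlt : βh < β)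
    -- C2 at `(β, t, t', U₂)`
    {a b : ℕ} (ha : 1 ≤ a) (hb : 1 ≤ b) {rows : List C2Row} {P K q A₀ : ℕ} {Wnum : ℤ} {Wden : ℕ}
    (hcheck : c2Check P K q A₀ a b rows Wnum Wden = true) (hn : n * ((q : ℝ) * a * b) = 2 * A₀)
    (hnode : ∀ r ∈ rows,
      r.floor ≤ (partitionFn β (spinSectorHamiltonian r.nu r.nd (hubbardOpenBoxTT' a b t t' U₂))).re)
    -- C1 (rectangle, `t' = 0`) at `(βh, μ, U₁)`
    (μ : ℝ) {a' b' : ℕ} (ha' : 2 ≤ a') (hb' : 2 ≤ b')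
    {ι : Type*} (sι : Finset ι) (Sw : ι → Finset (Site 2)) (hS : ∀ i, Sw i ⊆ rectWindow a' b') (zw : ι → Site 2)
    (hzw : ∀ i, shiftSet (zw i) (Sw i) ⊆ rectWindow a' b') {O : ∀ i, FermionOp (Sw i)}
    (hO : ∀ i ∈ sι, (O i).IsHermitian) (g : ι → ℝ)
    {LB : FermionOp ((rectWindow a' b').erase (mkSite2 (a' - 1) (b' - 1)))} (hLB : LB.IsHermitian) {c : ℝ}
    (hcert : ((Real.exp c : ℂ) • cfc Real.exp LB -
      fermionPartialTrace (PolySite.incl (Finset.erase_subset (mkSite2 (a' - 1) (b' - 1)) (rectWindow a' b')))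
        (cfc Real.exp (-((βh : ℂ) • (cornerEnergyRep (rectWindow a' b') (mkSite2 (a' - 1) (b' - 1)) t U₁ μ +
            windowAnnihilator sι (rectWindow a' b') Sw hS zw hzw O g)) +
          fermionEmbed (PolySite.incl (Finset.erase_subset (mkSite2 (a' - 1) (b' - 1)) (rectWindow a' b'))) LB))).PosSemidef) :
    ω.meanEnergy (hubbardTTPrimeFermionInteraction t t' U) 1 ≤
      ((c - βh * μ * n) + βh * |t'| * (16 / Real.pi ^ 2) - (Wnum : ℝ) / Wden) / (β - βh) :=
  h.meanEnergy_hubbardTTPrime_le_of_c2Check_right_of_cornerMarkovCertificate_tPrimeTransport_left_UCell_allTori hn2 hU hLs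
    hβh hlt ha hb hcheck hn hnode μ (rectCorner_mem_rectWindow (by omega) (by omega)) toLex_le_toLex_rectCorner
    (rectCorner_sub_unitVec_mem_rectWindow ha' hb') (rectWindow_subset_halfOpenBox_max a' b') sι Sw hS zw hzw hO g hLB hcert

/-- **Row-file edition** (the constant `16/π²` replaced by the decimal `16212/10000 ≥ 16/π²`): rectangle C1 at the left end,
sidecar at the right end, `U ∈ [U₁, U₂]` ⇒ `e_Φ(ω) ≤ ((c − β_h μ n) + β_h |t'| (16212/10000) − Wnum/Wden)/(β − β_h)`.
[cite: Israel1979, Lemma II.3.1] [cite: PoulinHastings2011, eqs. (3)–(8)] [cite: Lieb1973, §V (5.2)–(5.4)] -/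
theorem IsTorusLimitOfMixture.meanEnergy_hubbardTTPrime_le_of_c2Check_right_of_rectMarkovCertificate_tPrimeTransport_left_UCell_allTori'
    (hn2 : n < 2) {U₁ U₂ : ℝ} (hU : U ∈ Set.Icc U₁ U₂)
    (h : ω.IsTorusLimitOfMixture (sectorGibbsCount n) (fun L => sectorGibbsWeightTT' β t t' U n L)
      (fun L => sectorGibbsVectorTT' t t' U n L) Ls)
    (hLs : Tendsto Ls atTop atTop) {βh : ℝ} (hβh : 0 < βh) (hlt : βh < β)
    {a b : ℕ} (ha : 1 ≤ a) (hb : 1 ≤ b) {rows : List C2Row} {P K q A₀ : ℕ} {Wnum : ℤ} {Wden : ℕ}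
    (hcheck : c2Check P K q A₀ a b rows Wnum Wden = true) (hn : n * ((q : ℝ) * a * b) = 2 * A₀)
    (hnode : ∀ r ∈ rows,
      r.floor ≤ (partitionFn β (spinSectorHamiltonian r.nu r.nd (hubbardOpenBoxTT' a b t t' U₂))).re)
    (μ : ℝ) {a' b' : ℕ} (ha' : 2 ≤ a') (hb' : 2 ≤ b')
    {ι : Type*} (sι : Finset ι) (Sw : ι → Finset (Site 2)) (hS : ∀ i, Sw i ⊆ rectWindow a' b') (zw : ι → Site 2)
    (hzw : ∀ i, shiftSet (zw i) (Sw i) ⊆ rectWindow a' b') {O : ∀ i, FermionOp (Sw i)}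
    (hO : ∀ i ∈ sι, (O i).IsHermitian) (g : ι → ℝ)
    {LB : FermionOp ((rectWindow a' b').erase (mkSite2 (a' - 1) (b' - 1)))} (hLB : LB.IsHermitian) {c : ℝ}
    (hcert : ((Real.exp c : ℂ) • cfc Real.exp LB -
      fermionPartialTrace (PolySite.incl (Finset.erase_subset (mkSite2 (a' - 1) (b' - 1)) (rectWindow a' b')))
        (cfc Real.exp (-((βh : ℂ) • (cornerEnergyRep (rectWindow a' b') (mkSite2 (a' - 1) (b' - 1)) t U₁ μ +
            windowAnnihilator sι (rectWindow a' b') Sw hS zw hzw O g)) +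
          fermionEmbed (PolySite.incl (Finset.erase_subset (mkSite2 (a' - 1) (b' - 1)) (rectWindow a' b'))) LB))).PosSemidef) :
    ω.meanEnergy (hubbardTTPrimeFermionInteraction t t' U) 1 ≤
      ((c - βh * μ * n) + βh * |t'| * (16212 / 10000) - (Wnum : ℝ) / Wden) / (β - βh) := by
  have hmain := h.meanEnergy_hubbardTTPrime_le_of_c2Check_right_of_rectMarkovCertificate_tPrimeTransport_left_UCell_allTori
    hn2 hU hLs hβh hlt ha hb hcheck hn hnode μ ha' hb' sι Sw hS zw hzw hO g hLB hcert
  refine hmain.trans (div_le_div_of_nonneg_right ?_ (by linarith))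
  have hK := mul_le_mul_of_nonneg_left sixteen_div_pi_sq_lt.le (mul_nonneg hβh.le (abs_nonneg t'))
  linarith

/-! ### §2 One anchor `U₀` at `t' ≠ 0`: the cell at every `U`, kinematic `U`-prices on both sides -/

/-- **BOTH certificates at ONE anchor `U₀`, `t' ≠ 0`, the cell at EVERY `U`, kinematic prices**: checked sidecar AT
`(β, t, t', U₀)`, `t' = 0` CORNER Markov certificate at `(β_h, μ, U₀)` transported along `t'`; for every torus limit at
`(β, t, t', U, n)` (`0 ≤ n < 2`, `0 < β_h < β`):
`e_Φ(ω) ≤ ((c − β_h μ n) + β_h |t'| 16/π² + β_h·max(U₀ − U, 0)·n/2 − (Wnum/Wden − β·max(U − U₀, 0)·n/2))/(β − β_h)`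
(below the anchor the hot ceiling pays, above it the cold floor pays; exactly one `max` is nonzero).
[cite: Israel1979, Lemma II.3.1] [cite: Lieb1973, §V (5.2)–(5.4)] [cite: PoulinHastings2011, eqs. (3)–(8)] -/
theorem IsTorusLimitOfMixture.meanEnergy_hubbardTTPrime_le_of_c2Check_of_cornerMarkovCertificate_tPrimeTransport_allTori_anchorU_kinematic
    (hn2 : n < 2) (U₀ : ℝ)
    (h : ω.IsTorusLimitOfMixture (sectorGibbsCount n) (fun L => sectorGibbsWeightTT' β t t' U n L)
      (fun L => sectorGibbsVectorTT' t t' U n L) Ls)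
    (hLs : Tendsto Ls atTop atTop) {βh : ℝ} (hβh : 0 < βh) (hlt : βh < β)
    -- C2 at `(β, t, t', U₀)`
    {a b : ℕ} (ha : 1 ≤ a) (hb : 1 ≤ b) {rows : List C2Row} {P K q A₀ : ℕ} {Wnum : ℤ} {Wden : ℕ}
    (hcheck : c2Check P K q A₀ a b rows Wnum Wden = true) (hn : n * ((q : ℝ) * a * b) = 2 * A₀)
    (hnode : ∀ r ∈ rows,
      r.floor ≤ (partitionFn β (spinSectorHamiltonian r.nu r.nd (hubbardOpenBoxTT' a b t t' U₀))).re)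
    -- C1 (corner window, `t' = 0`) at `(βh, μ, U₀)`
    (μ : ℝ) {Λ : Finset (Site 2)} {x₀ : Site 2} (hx₀ : x₀ ∈ Λ) (hmax : ∀ y ∈ Λ, toLex y ≤ toLex x₀)
    (hcorner : ∀ i : Fin 2, x₀ - unitVec i ∈ Λ) {ℓw : ℕ} (hΛ : Λ ⊆ halfOpenBox 2 ℓw)
    {ι : Type*} (sι : Finset ι) (Sw : ι → Finset (Site 2)) (hS : ∀ i, Sw i ⊆ Λ) (zw : ι → Site 2)
    (hzw : ∀ i, shiftSet (zw i) (Sw i) ⊆ Λ) {O : ∀ i, FermionOp (Sw i)} (hO : ∀ i ∈ sι, (O i).IsHermitian)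
    (g : ι → ℝ) {LB : FermionOp (Λ.erase x₀)} (hLB : LB.IsHermitian) {c : ℝ}
    (hcert : ((Real.exp c : ℂ) • cfc Real.exp LB -
      fermionPartialTrace (PolySite.incl (Finset.erase_subset x₀ Λ))
        (cfc Real.exp (-((βh : ℂ) • (cornerEnergyRep Λ x₀ t U₀ μ + windowAnnihilator sι Λ Sw hS zw hzw O g)) +
          fermionEmbed (PolySite.incl (Finset.erase_subset x₀ Λ)) LB))).PosSemidef) :
    ω.meanEnergy (hubbardTTPrimeFermionInteraction t t' U) 1 ≤
      (((c - βh * μ * n) + βh * |t'| * (16 / Real.pi ^ 2)) + βh * max (U₀ - U) 0 * (n / 2) -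
        ((Wnum : ℝ) / Wden - β * max (U - U₀) 0 * (n / 2))) / (β - βh) := by
  obtain ⟨-, hq, -⟩ := c2Check_sound hcheck ha hb
  have hn0 : 0 ≤ n := density_nonneg_of_type ha hb hq hn
  have hβ : 0 ≤ β := (hβh.trans hlt).le
  exact h.meanEnergy_hubbardTTPrime_le_of_pressure_bounds_anchorU_kinematic hn0 hn2.le U₀ hLs hβh hlt
    (fun ε hε => eventually_pressureFloor_of_c2Check_of_le_U t t' n le_rfl hβ ha hb hcheck hn hn2.le hnode hLs hε)
    (eventually_log_partitionFn_sector_le_of_cornerMarkovCertificate_tPrimeTransport hn0 hn2 t t' U₀ hβh hLs μ hx₀ hmax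
      hcorner hΛ sι Sw hS zw hzw hO g hLB hcert)

/-- **Rectangle corollary of the one-anchor kinematic cell at `t' ≠ 0`** (`Λ = rectWindow a' b'`, `a', b' ≥ 2`).
[cite: Israel1979, Lemma II.3.1] [cite: Lieb1973, §V (5.2)–(5.4)] [cite: PoulinHastings2011, eqs. (3)–(8)] -/
theorem IsTorusLimitOfMixture.meanEnergy_hubbardTTPrime_le_of_c2Check_of_rectMarkovCertificate_tPrimeTransport_allTori_anchorU_kinematic
    (hn2 : n < 2) (U₀ : ℝ)
    (h : ω.IsTorusLimitOfMixture (sectorGibbsCount n) (fun L => sectorGibbsWeightTT' β t t' U n L)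
      (fun L => sectorGibbsVectorTT' t t' U n L) Ls)
    (hLs : Tendsto Ls atTop atTop) {βh : ℝ} (hβh : 0 < βh) (hlt : βh < β)
    -- C2 at `(β, t, t', U₀)`
    {a b : ℕ} (ha : 1 ≤ a) (hb : 1 ≤ b) {rows : List C2Row} {P K q A₀ : ℕ} {Wnum : ℤ} {Wden : ℕ}
    (hcheck : c2Check P K q A₀ a b rows Wnum Wden = true) (hn : n * ((q : ℝ) * a * b) = 2 * A₀)
    (hnode : ∀ r ∈ rows,
      r.floor ≤ (partitionFn β (spinSectorHamiltonian r.nu r.nd (hubbardOpenBoxTT' a b t t' U₀))).re)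
    -- C1 (rectangle, `t' = 0`) at `(βh, μ, U₀)`
    (μ : ℝ) {a' b' : ℕ} (ha' : 2 ≤ a') (hb' : 2 ≤ b')
    {ι : Type*} (sι : Finset ι) (Sw : ι → Finset (Site 2)) (hS : ∀ i, Sw i ⊆ rectWindow a' b') (zw : ι → Site 2)
    (hzw : ∀ i, shiftSet (zw i) (Sw i) ⊆ rectWindow a' b') {O : ∀ i, FermionOp (Sw i)}
    (hO : ∀ i ∈ sι, (O i).IsHermitian) (g : ι → ℝ)
    {LB : FermionOp ((rectWindow a' b').erase (mkSite2 (a' - 1) (b' - 1)))} (hLB : LB.IsHermitian) {c : ℝ}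
    (hcert : ((Real.exp c : ℂ) • cfc Real.exp LB -
      fermionPartialTrace (PolySite.incl (Finset.erase_subset (mkSite2 (a' - 1) (b' - 1)) (rectWindow a' b')))
        (cfc Real.exp (-((βh : ℂ) • (cornerEnergyRep (rectWindow a' b') (mkSite2 (a' - 1) (b' - 1)) t U₀ μ +
            windowAnnihilator sι (rectWindow a' b') Sw hS zw hzw O g)) +
          fermionEmbed (PolySite.incl (Finset.erase_subset (mkSite2 (a' - 1) (b' - 1)) (rectWindow a' b'))) LB))).PosSemidef) :
    ω.meanEnergy (hubbardTTPrimeFermionInteraction t t' U) 1 ≤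
      (((c - βh * μ * n) + βh * |t'| * (16 / Real.pi ^ 2)) + βh * max (U₀ - U) 0 * (n / 2) -
        ((Wnum : ℝ) / Wden - β * max (U - U₀) 0 * (n / 2))) / (β - βh) :=
  h.meanEnergy_hubbardTTPrime_le_of_c2Check_of_cornerMarkovCertificate_tPrimeTransport_allTori_anchorU_kinematic hn2 U₀ hLs
    hβh hlt ha hb hcheck hn hnode μ (rectCorner_mem_rectWindow (by omega) (by omega)) toLex_le_toLex_rectCorner
    (rectCorner_sub_unitVec_mem_rectWindow ha' hb') (rectWindow_subset_halfOpenBox_max a' b') sι Sw hS zw hzw hO g hLB hcert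

/-- **Row-file edition of the one-anchor kinematic cell at `t' ≠ 0`** (`16/π²` replaced by `16212/10000`):
`e_Φ(ω) ≤ ((c − β_h μ n) + β_h |t'| (16212/10000) + β_h·max(U₀ − U, 0)·n/2 − (Wnum/Wden − β·max(U − U₀, 0)·n/2))/(β − β_h)`.
[cite: Israel1979, Lemma II.3.1] [cite: Lieb1973, §V (5.2)–(5.4)] [cite: PoulinHastings2011, eqs. (3)–(8)] -/
theorem IsTorusLimitOfMixture.meanEnergy_hubbardTTPrime_le_of_c2Check_of_rectMarkovCertificate_tPrimeTransport_allTori_anchorU_kinematic'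
    (hn2 : n < 2) (U₀ : ℝ)
    (h : ω.IsTorusLimitOfMixture (sectorGibbsCount n) (fun L => sectorGibbsWeightTT' β t t' U n L)
      (fun L => sectorGibbsVectorTT' t t' U n L) Ls)
    (hLs : Tendsto Ls atTop atTop) {βh : ℝ} (hβh : 0 < βh) (hlt : βh < β)
    {a b : ℕ} (ha : 1 ≤ a) (hb : 1 ≤ b) {rows : List C2Row} {P K q A₀ : ℕ} {Wnum : ℤ} {Wden : ℕ}
    (hcheck : c2Check P K q A₀ a b rows Wnum Wden = true) (hn : n * ((q : ℝ) * a * b) = 2 * A₀)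
    (hnode : ∀ r ∈ rows,
      r.floor ≤ (partitionFn β (spinSectorHamiltonian r.nu r.nd (hubbardOpenBoxTT' a b t t' U₀))).re)
    (μ : ℝ) {a' b' : ℕ} (ha' : 2 ≤ a') (hb' : 2 ≤ b')
    {ι : Type*} (sι : Finset ι) (Sw : ι → Finset (Site 2)) (hS : ∀ i, Sw i ⊆ rectWindow a' b') (zw : ι → Site 2)
    (hzw : ∀ i, shiftSet (zw i) (Sw i) ⊆ rectWindow a' b') {O : ∀ i, FermionOp (Sw i)}
    (hO : ∀ i ∈ sι, (O i).IsHermitian) (g : ι → ℝ)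
    {LB : FermionOp ((rectWindow a' b').erase (mkSite2 (a' - 1) (b' - 1)))} (hLB : LB.IsHermitian) {c : ℝ}
    (hcert : ((Real.exp c : ℂ) • cfc Real.exp LB -
      fermionPartialTrace (PolySite.incl (Finset.erase_subset (mkSite2 (a' - 1) (b' - 1)) (rectWindow a' b')))
        (cfc Real.exp (-((βh : ℂ) • (cornerEnergyRep (rectWindow a' b') (mkSite2 (a' - 1) (b' - 1)) t U₀ μ +
            windowAnnihilator sι (rectWindow a' b') Sw hS zw hzw O g)) +
          fermionEmbed (PolySite.incl (Finset.erase_subset (mkSite2 (a' - 1) (b' - 1)) (rectWindow a' b'))) LB))).PosSemidef) :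
    ω.meanEnergy (hubbardTTPrimeFermionInteraction t t' U) 1 ≤
      (((c - βh * μ * n) + βh * |t'| * (16212 / 10000)) + βh * max (U₀ - U) 0 * (n / 2) -
        ((Wnum : ℝ) / Wden - β * max (U - U₀) 0 * (n / 2))) / (β - βh) := by
  have hmain := h.meanEnergy_hubbardTTPrime_le_of_c2Check_of_rectMarkovCertificate_tPrimeTransport_allTori_anchorU_kinematic
    hn2 U₀ hLs hβh hlt ha hb hcheck hn hnode μ ha' hb' sι Sw hS zw hzw hO g hLB hcert
  refine hmain.trans (div_le_div_of_nonneg_right ?_ (by linarith))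
  have hK := mul_le_mul_of_nonneg_left sixteen_div_pi_sq_lt.le (mul_nonneg hβh.le (abs_nonneg t'))
  linarith

end InfVolFermionState

end Literature.MathematicalPhysics.QuantumLattice

end
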